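/-
Copyright (c) 2026 the pub-hodgecm-mathlib formalisation cell (harness21).  Prover seat hodgecm-mathlib-LH7-p04 (g11), 2026-09-02.
Road M6 → F3 «TOT-Λ BY OVER-ORDERS» (dealer LH4-plan (g8) WORD #69∕#70, DEAL g8-#19a), brick F3-1b «GLUED OVER-ORDERS: THE COUNT `H(N″, b)`».
-/
import Literature.NumberTheory.Automorphic.LocalOrderUnitIndex   -- ★ O2 (F0P3-p02): `IsUniformizingElement`, `natCard_quotient_span_pow`, `natCard_units_quotient_span_uniformizer_pow`
import HarnessLib

/-!
# Counting hermitian compatible characters at a level: the function `H(N″, b)` of the over-order law (F3-0)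

Topic `NumberTheory/Automorphic`; namespace `Literature.NumberTheory.Automorphic`.  THEOREMS ONLY (no definition, no instance, no notation, no named fact, no `sorry`).
Cell `pub/hodgecm-mathlib` (D-0151), crux H413 = `stmt-HodgeConjecture-24833`; road M6 → F3 «TOT-Λ by over-orders» (route (B), gate F3-0 = FIT), brick **F3-1b** (sequel of ★ F3-1a
`GluedOverOrders`: there the `⋆`-stable glued over-orders of the type-(2) order are shown to be the `G(N″, b, ιO y)` with `y ∈ 𝒪_F`; here we COUNT the admissible `y mod ϖ^b`).
Currency: a valued field `F` (`ValuativeRel F`, `𝒪 = 𝒪[F]`, `𝓀 = 𝓀[F]`, `q = Nat.card 𝓀[F]`, `hϖ : IsUniformizingElement ϖ`, `π = ⟨ϖ, _⟩ ∈ 𝒪`) — pure DVR counting, no `E`, no `O₁`, no `2`, no `d`.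
HONEST LABEL: HC_CM is proved only modulo the 2 remaining named inputs (hLiu418 24832, h413 24833) until rung 0 closes; elementary counting in `𝒪 ⧸ ϖ^s`, asserts nothing printed;
count-neutral base-layer brick ((O4) is not an organ).

THE MATHEMATICS.  Everything follows from ONE MASTER COUNT (§2): for `r ≤ s`, `k`, `c ∈ 𝒪`, the classes `w ∈ 𝒪 ⧸ π^s` having a representative `y ∈ (π^r)` with `π^k y ≡ c (mod π^s)`
form — when non-empty, i.e. iff `c ∈ (π^{min(s, k+r)})` — a coset of the image of `(π^{max(r, s−k)})`, so their number is `q^{s − max(r, s−k)}` (§1: `#((π^a) mod π^s) = q^{s−a}` from ★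
`natCard_quotient_span_pow` and `Submodule.card_quotient_mul_card_quotient`).  The two heads are its specialisations (F3-0 §0.1 ∕ SIG-F3-1 §4 (C1)(C2), the `H` of the 586-identity oracle
`f3/f30_ansatz.py`): (C1) ODD LEVEL `b = 2N″+1` (`r = N″+1`, `k = N − N″`): `q^{min(N″, N−N″)}` if `c ∈ (π^{min(b, N+1)})`, else `0`; (C2) EVEN LEVEL `b = 2M ≤ 2N″` (exact character:
representative in `(π^M) ∖ (π^{M+1})` = master at `r = M` minus master at `r = M+1`): `(q − 1)q^{M−1}·[c ∈ (π^{2M})]` if `M ≤ N − N″`, and `q^{N−N″}·[c ∈ (π^{M+N−N″}) ∖ (π^{M+N−N″+1})]`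
if `M > N − N″`.  (C3) `b = 0`: one class.  With F3-1a these are the numbers of `⋆`-stable glued over-orders of `R = G(N, n, c)` at `(N″, b)`; F3-4 sums `g(b)·q^{N″}·H` to `phiTHn ∕ phiTHprimen`.

* §1 `span_pow_le_span_pow_iff`, `mem_span_pow_of_mem_of_mem`, `natCard_map_mkQ_span_pow`.
* §2 **`natCard_liftClasses_eq`** (the master count).
* §3 **`natCard_hermitianChars_odd`** (C1), **`natCard_hermitianChars_even`** (C2), `natCard_hermitianChars_zero` (C3).

## References
* [Neukirch1999] J. Neukirch, *Algebraic Number Theory*, Grundlehren 322 (1999): Ch. I §12 (orders of conductor `f`, counting residue classes).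
* [SerreLocalFields1979] J.-P. Serre, *Local Fields*, GTM 67 (1979): Ch. I §6; Ch. IV §1 (filtration `(π^n)` and its successive quotients).
* [Macdonald1995] I. G. Macdonald, *Symmetric Functions and Hall Polynomials* (2nd ed. 1995): Ch. II §1 (1.4) (`#(𝒪 ⧸ π^m) = q^m`).
-/

set_option autoImplicit false

open scoped ValuativeRel

namespace Literature.NumberTheory.Automorphic

variable {F : Type*} [Field F] [ValuativeRel F] {ϖ : F} (hϖ : IsUniformizingElement ϖ)

/-! ## §1 Powers of the uniformiser: inclusions and the count `#((π^a) mod π^s) = q^{s−a}` -/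

include hϖ in
/-- `(π^a) ≤ (π^b) ↔ b ≤ a`. [cite: SerreLocalFields1979, Ch. IV §1] -/
theorem span_pow_le_span_pow_iff [IsDiscreteValuationRing 𝒪[F]] (a b : ℕ) :
    Ideal.span ({(⟨ϖ, hϖ.mem⟩ : 𝒪[F]) ^ a} : Set 𝒪[F]) ≤ Ideal.span {(⟨ϖ, hϖ.mem⟩ : 𝒪[F]) ^ b} ↔ b ≤ a := by
  rw [Ideal.span_singleton_le_span_singleton, hϖ.coe_pow_dvd_pow_iff]

/-- An element of `(π^a)` and of `(π^b)` lies in `(π^{max a b})` (the larger exponent is one of the two). [cite: SerreLocalFields1979, Ch. IV §1] -/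
theorem mem_span_pow_max_of_mem_of_mem (π : 𝒪[F]) (a b : ℕ) {d : 𝒪[F]}
    (ha : d ∈ Ideal.span ({π ^ a} : Set 𝒪[F])) (hb : d ∈ Ideal.span ({π ^ b} : Set 𝒪[F])) :
    d ∈ Ideal.span ({π ^ max a b} : Set 𝒪[F]) := by
  rcases le_total a b with h | h
  · rwa [max_eq_right h]
  · rwa [max_eq_left h]

include hϖ in
/-- **`#((π^a) mod π^s) = q^{s−a}`** for `a ≤ s` (`#(𝒪⧸π^s) = #((π^a)⧸(π^s))·#(𝒪⧸π^a)` and ★ `natCard_quotient_span_pow`). [cite: Macdonald1995, Ch. II §1 (1.4)] -/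
theorem natCard_map_mkQ_span_pow [Finite 𝓀[F]] {a s : ℕ} (has : a ≤ s) :
    Nat.card (Submodule.map (Submodule.mkQ (Ideal.span ({(⟨ϖ, hϖ.mem⟩ : 𝒪[F]) ^ s} : Set 𝒪[F])))
        (Ideal.span ({(⟨ϖ, hϖ.mem⟩ : 𝒪[F]) ^ a} : Set 𝒪[F]))) = Nat.card 𝓀[F] ^ (s - a) := by
  set π : 𝒪[F] := ⟨ϖ, hϖ.mem⟩ with hπ
  set S : Submodule 𝒪[F] 𝒪[F] := Ideal.span ({π ^ a} : Set 𝒪[F]) with hS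
  set T : Submodule 𝒪[F] 𝒪[F] := Ideal.span ({π ^ s} : Set 𝒪[F]) with hT
  have hTS : T ≤ S := Ideal.span_singleton_le_span_singleton.2 (pow_dvd_pow π has)
  have h := Submodule.card_quotient_mul_card_quotient S T hTS
  have hS' : Nat.card (𝒪[F] ⧸ S) = Nat.card 𝓀[F] ^ a := natCard_quotient_span_pow hϖ a
  have hT' : Nat.card (𝒪[F] ⧸ T) = Nat.card 𝓀[F] ^ s := natCard_quotient_span_pow hϖ s
  rw [hS', hT'] at h
  have hq : 0 < Nat.card 𝓀[F] := Nat.card_pos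
  have hsa : Nat.card 𝓀[F] ^ s = Nat.card 𝓀[F] ^ (s - a) * Nat.card 𝓀[F] ^ a := by
    rw [← pow_add, Nat.sub_add_cancel has]
  rw [hsa] at h
  exact Nat.eq_of_mul_eq_mul_right (pow_pos hq a) h

/-! ## §2 The master count: classes mod `π^s` with a representative in `(π^r)` satisfying `π^k y ≡ c` -/

open scoped Classical in
include hϖ in
/-- **THE MASTER COUNT.**  For `r ≤ s`: `#{w ∈ 𝒪⧸π^s | ∃ y ↦ w, y ∈ (π^r), π^k y ≡ c (mod π^s)} = q^{s − max(r, s−k)}` if `c ∈ (π^{min(s, k+r)})`, and `0` otherwise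
(a non-empty solution set is a coset of `((π^r) ∩ (π^{s−k})) mod π^s = (π^{max(r, s−k)}) mod π^s`; ℕ-subtraction: `s − k = 0` when `k ≥ s`). [cite: Neukirch1999, Ch. I §12]
[cite: SerreLocalFields1979, Ch. IV §1] -/
theorem natCard_liftClasses_eq [Finite 𝓀[F]] [IsDiscreteValuationRing 𝒪[F]] {r s : ℕ} (hrs : r ≤ s) (k : ℕ) (c : 𝒪[F]) :
    Nat.card {w : 𝒪[F] ⧸ Ideal.span ({(⟨ϖ, hϖ.mem⟩ : 𝒪[F]) ^ s} : Set 𝒪[F]) //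
        ∃ y : 𝒪[F], Ideal.Quotient.mk _ y = w ∧ y ∈ Ideal.span ({(⟨ϖ, hϖ.mem⟩ : 𝒪[F]) ^ r} : Set 𝒪[F]) ∧
          (⟨ϖ, hϖ.mem⟩ : 𝒪[F]) ^ k * y - c ∈ Ideal.span ({(⟨ϖ, hϖ.mem⟩ : 𝒪[F]) ^ s} : Set 𝒪[F])} =
      if c ∈ Ideal.span ({(⟨ϖ, hϖ.mem⟩ : 𝒪[F]) ^ min s (k + r)} : Set 𝒪[F]) then Nat.card 𝓀[F] ^ (s - max r (s - k)) else 0 := by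
  classical
  set π : 𝒪[F] := ⟨ϖ, hϖ.mem⟩ with hπ
  have hπ0 : π ≠ 0 := hϖ.coe_ne_zero
  set T : Ideal 𝒪[F] := Ideal.span ({π ^ s} : Set 𝒪[F]) with hT
  set A : Ideal 𝒪[F] := Ideal.span ({π ^ r} : Set 𝒪[F]) with hA
  -- monotonicity of the `π`-adic ideals
  have hle : ∀ {a b : ℕ}, b ≤ a → Ideal.span ({π ^ a} : Set 𝒪[F]) ≤ Ideal.span {π ^ b} := fun {a b} h =>
    Ideal.span_singleton_le_span_singleton.2 (pow_dvd_pow π h)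
  split_ifs with hc
  · -- a particular solution `y_p`
    obtain ⟨yp, hypA, hypT⟩ : ∃ yp : 𝒪[F], yp ∈ A ∧ π ^ k * yp - c ∈ T := by
      obtain ⟨c₁, hc₁⟩ := Ideal.mem_span_singleton'.1 hc
      rcases le_or_gt (k + r) s with hkr | hkr
      · -- `c = π^{k+r} c₁`, `y_p = π^r c₁`
        rw [min_eq_right hkr] at hc₁
        refine ⟨c₁ * π ^ r, Ideal.mem_span_singleton'.2 ⟨c₁, rfl⟩, ?_⟩
        have : π ^ k * (c₁ * π ^ r) - c = 0 := by rw [← hc₁, pow_add]; ring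
        rw [this]; exact T.zero_mem
      · -- `c ∈ (π^s)`, `y_p = 0`
        rw [min_eq_left hkr.le] at hc₁
        refine ⟨0, A.zero_mem, ?_⟩
        rw [mul_zero, zero_sub]
        exact T.neg_mem (Ideal.mem_span_singleton'.2 ⟨c₁, hc₁⟩)
    -- the solution set is the coset `w_p + ((π^{max r (s-k)}) mod π^s)`
    set r' : ℕ := max r (s - k) with hr'
    have hr's : r' ≤ s := max_le hrs (Nat.sub_le s k)
    set H : Submodule 𝒪[F] (𝒪[F] ⧸ T) := Submodule.map (Submodule.mkQ T) (Ideal.span ({π ^ r'} : Set 𝒪[F])) with hH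
    -- key: `d ∈ (π^r)` and `π^k d ∈ (π^s)` iff `d ∈ (π^{r'})`
    have hD : ∀ d : 𝒪[F], d ∈ A → π ^ k * d ∈ T → d ∈ Ideal.span ({π ^ r'} : Set 𝒪[F]) := by
      intro d hdA hdT
      refine mem_span_pow_max_of_mem_of_mem π r (s - k) hdA ?_
      rcases le_or_gt k s with hks | hks
      · obtain ⟨t, ht⟩ := Ideal.mem_span_singleton'.1 hdT
        refine Ideal.mem_span_singleton'.2 ⟨t, ?_⟩
        have h1 : π ^ k * (t * π ^ (s - k)) = π ^ k * d := by
          rw [← ht, mul_comm t, ← mul_assoc, ← pow_add, Nat.add_sub_cancel' hks, mul_comm]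
        exact mul_left_cancel₀ (pow_ne_zero k hπ0) h1
      · rw [Nat.sub_eq_zero_of_le hks.le, pow_zero, Ideal.span_singleton_one]; trivial
    have hD' : ∀ d : 𝒪[F], d ∈ Ideal.span ({π ^ r'} : Set 𝒪[F]) → d ∈ A ∧ π ^ k * d ∈ T := by
      intro d hd
      refine ⟨hle (le_max_left _ _) hd, ?_⟩
      have hd' : d ∈ Ideal.span ({π ^ (s - k)} : Set 𝒪[F]) := hle (le_max_right _ _) hd
      obtain ⟨t, ht⟩ := Ideal.mem_span_singleton'.1 hd'
      refine hle (show s ≤ k + (s - k) by omega) (Ideal.mem_span_singleton'.2 ⟨t, ?_⟩)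
      rw [← ht, pow_add]; ring
    -- the bijection with `H`
    have hiff : ∀ w : 𝒪[F] ⧸ T, (∃ y : 𝒪[F], Ideal.Quotient.mk T y = w ∧ y ∈ A ∧ π ^ k * y - c ∈ T) ↔ w - Ideal.Quotient.mk T yp ∈ H := by
      intro w
      constructor
      · rintro ⟨y, rfl, hyA, hyT⟩
        refine ⟨y - yp, hD (y - yp) (A.sub_mem hyA hypA) ?_, by simp⟩
        have : π ^ k * (y - yp) = (π ^ k * y - c) - (π ^ k * yp - c) := by ring
        rw [this]; exact T.sub_mem hyT hypT
      · rintro ⟨d, hd, hdy⟩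
        obtain ⟨hdA, hdT⟩ := hD' d hd
        refine ⟨yp + d, ?_, A.add_mem hypA hdA, ?_⟩
        · have hdy' : Ideal.Quotient.mk T d = w - Ideal.Quotient.mk T yp := hdy
          rw [map_add, hdy']; abel
        · have : π ^ k * (yp + d) - c = (π ^ k * yp - c) + π ^ k * d := by ring
          rw [this]; exact T.add_mem hypT hdT
    have e : {w : 𝒪[F] ⧸ T // ∃ y : 𝒪[F], Ideal.Quotient.mk T y = w ∧ y ∈ A ∧ π ^ k * y - c ∈ T} ≃ H :=
      { toFun := fun x => ⟨x.1 - Ideal.Quotient.mk T yp, (hiff x.1).1 x.2⟩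
        invFun := fun h => ⟨h.1 + Ideal.Quotient.mk T yp, (hiff _).2 (by simp)⟩
        left_inv := fun x => by simp
        right_inv := fun h => by simp }
    rw [Nat.card_congr e, hH, natCard_map_mkQ_span_pow hϖ hr's]
  · -- no solution: a solution would put `c` in `(π^{min s (k+r)})`
    rw [Nat.card_eq_zero]
    left
    refine ⟨fun ⟨w, y, _, hyA, hyT⟩ => hc ?_⟩
    have h1 : π ^ k * y ∈ Ideal.span ({π ^ min s (k + r)} : Set 𝒪[F]) := by
      obtain ⟨t, ht⟩ := Ideal.mem_span_singleton'.1 hyA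
      refine hle (min_le_right _ _) (Ideal.mem_span_singleton'.2 ⟨t, ?_⟩)
      rw [← ht, pow_add]; ring
    have h2 : π ^ k * y - c ∈ Ideal.span ({π ^ min s (k + r)} : Set 𝒪[F]) := hle (min_le_left _ _) hyT
    have : c = π ^ k * y - (π ^ k * y - c) := by ring
    rw [this]
    exact Ideal.sub_mem _ h1 h2


/-! ## §3 The two heads: `H(N″, b)` at odd and even levels (F3-0 §0.1 ∕ SIG-F3-1 §4) -/

open scoped Classical in
include hϖ in
/-- **(C1) ODD LEVEL `b = 2N″+1`.**  The hermitian characters of `O_{N″}` at the odd level compatible with `R = G(N, n, c)` (`k = N − N″`): classes `w mod π^{2N″+1}` with a representative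
`y ∈ (π^{N″+1})` and `π^{N−N″} y ≡ c`; their number is `q^{min(N″, N−N″)}` if `c ∈ (π^{min(2N″+1, N+1)})` and `0` otherwise — the `H(N″, 2N″+1)` of F3-0.
[cite: Neukirch1999, Ch. I §12] [cite: SerreLocalFields1979, Ch. IV §1] -/
theorem natCard_hermitianChars_odd [Finite 𝓀[F]] [IsDiscreteValuationRing 𝒪[F]] {N N'' : ℕ} (hN : N'' ≤ N) (c : 𝒪[F]) :
    Nat.card {w : 𝒪[F] ⧸ Ideal.span ({(⟨ϖ, hϖ.mem⟩ : 𝒪[F]) ^ (2 * N'' + 1)} : Set 𝒪[F]) //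
        ∃ y : 𝒪[F], Ideal.Quotient.mk _ y = w ∧ y ∈ Ideal.span ({(⟨ϖ, hϖ.mem⟩ : 𝒪[F]) ^ (N'' + 1)} : Set 𝒪[F]) ∧
          (⟨ϖ, hϖ.mem⟩ : 𝒪[F]) ^ (N - N'') * y - c ∈ Ideal.span ({(⟨ϖ, hϖ.mem⟩ : 𝒪[F]) ^ (2 * N'' + 1)} : Set 𝒪[F])} =
      if c ∈ Ideal.span ({(⟨ϖ, hϖ.mem⟩ : 𝒪[F]) ^ min (2 * N'' + 1) (N + 1)} : Set 𝒪[F]) then Nat.card 𝓀[F] ^ min N'' (N - N'') else 0 := by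
  have h := natCard_liftClasses_eq hϖ (r := N'' + 1) (s := 2 * N'' + 1) (by omega) (N - N'') c
  have e1 : N - N'' + (N'' + 1) = N + 1 := by omega
  have e2 : 2 * N'' + 1 - max (N'' + 1) (2 * N'' + 1 - (N - N'')) = min N'' (N - N'') := by omega
  rw [e1, e2] at h
  exact h

open scoped Classical in
include hϖ in
/-- **(C2) EVEN LEVEL `b = 2M`, `1 ≤ M ≤ N″`** (EXACT character: representative in `(π^M) ∖ (π^{M+1})`), `k = N − N″`: the number of compatible hermitian characters is
`(q − 1)·q^{M−1}·[c ∈ (π^{2M})]` if `M ≤ k`, and `q^k·[c ∈ (π^{M+k}) ∖ (π^{M+k+1})]` if `k < M` — the `H(N″, 2M)` of F3-0 (master count at `r = M` minus master count at `r = M+1`).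
[cite: Neukirch1999, Ch. I §12] [cite: SerreLocalFields1979, Ch. IV §1] -/
theorem natCard_hermitianChars_even [Finite 𝓀[F]] [IsDiscreteValuationRing 𝒪[F]] {N N'' M : ℕ} (hM1 : 1 ≤ M) (hMN : M ≤ N'') (c : 𝒪[F]) :
    Nat.card {w : 𝒪[F] ⧸ Ideal.span ({(⟨ϖ, hϖ.mem⟩ : 𝒪[F]) ^ (2 * M)} : Set 𝒪[F]) //
        ∃ y : 𝒪[F], Ideal.Quotient.mk _ y = w ∧ y ∈ Ideal.span ({(⟨ϖ, hϖ.mem⟩ : 𝒪[F]) ^ M} : Set 𝒪[F]) ∧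
          y ∉ Ideal.span ({(⟨ϖ, hϖ.mem⟩ : 𝒪[F]) ^ (M + 1)} : Set 𝒪[F]) ∧
          (⟨ϖ, hϖ.mem⟩ : 𝒪[F]) ^ (N - N'') * y - c ∈ Ideal.span ({(⟨ϖ, hϖ.mem⟩ : 𝒪[F]) ^ (2 * M)} : Set 𝒪[F])} =
      if M ≤ N - N'' then
        (if c ∈ Ideal.span ({(⟨ϖ, hϖ.mem⟩ : 𝒪[F]) ^ (2 * M)} : Set 𝒪[F]) then (Nat.card 𝓀[F] - 1) * Nat.card 𝓀[F] ^ (M - 1) else 0)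
      else
        (if c ∈ Ideal.span ({(⟨ϖ, hϖ.mem⟩ : 𝒪[F]) ^ (M + (N - N''))} : Set 𝒪[F]) ∧
            c ∉ Ideal.span ({(⟨ϖ, hϖ.mem⟩ : 𝒪[F]) ^ (M + (N - N'') + 1)} : Set 𝒪[F]) then Nat.card 𝓀[F] ^ (N - N'') else 0) := by
  set π : 𝒪[F] := ⟨ϖ, hϖ.mem⟩ with hπ
  set k : ℕ := N - N'' with hk
  set T : Ideal 𝒪[F] := Ideal.span ({π ^ (2 * M)} : Set 𝒪[F]) with hT
  have hle : ∀ {a b : ℕ}, b ≤ a → Ideal.span ({π ^ a} : Set 𝒪[F]) ≤ Ideal.span {π ^ b} := fun {a b} h =>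
    Ideal.span_singleton_le_span_singleton.2 (pow_dvd_pow π h)
  -- the two coset counts from the master count
  set U : Set (𝒪[F] ⧸ T) := {w | ∃ y : 𝒪[F], Ideal.Quotient.mk T y = w ∧ y ∈ Ideal.span ({π ^ M} : Set 𝒪[F]) ∧ π ^ k * y - c ∈ T} with hU
  set V : Set (𝒪[F] ⧸ T) := {w | ∃ y : 𝒪[F], Ideal.Quotient.mk T y = w ∧ y ∈ Ideal.span ({π ^ (M + 1)} : Set 𝒪[F]) ∧ π ^ k * y - c ∈ T} with hV
  have hU' : Nat.card U = if c ∈ Ideal.span ({π ^ min (2 * M) (k + M)} : Set 𝒪[F]) then Nat.card 𝓀[F] ^ (2 * M - max M (2 * M - k)) else 0 :=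
    natCard_liftClasses_eq hϖ (r := M) (s := 2 * M) (by omega) k c
  have hV' : Nat.card V = if c ∈ Ideal.span ({π ^ min (2 * M) (k + (M + 1))} : Set 𝒪[F]) then Nat.card 𝓀[F] ^ (2 * M - max (M + 1) (2 * M - k)) else 0 :=
    natCard_liftClasses_eq hϖ (r := M + 1) (s := 2 * M) (by omega) k c
  have hVU : V ⊆ U := by
    rintro w ⟨y, hyw, hy, hyc⟩
    exact ⟨y, hyw, hle (Nat.le_succ M) hy, hyc⟩
  -- the target set is `U \ V`
  have hS : ({w : 𝒪[F] ⧸ T | ∃ y : 𝒪[F], Ideal.Quotient.mk T y = w ∧ y ∈ Ideal.span ({π ^ M} : Set 𝒪[F]) ∧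
      y ∉ Ideal.span ({π ^ (M + 1)} : Set 𝒪[F]) ∧ π ^ k * y - c ∈ T} : Set (𝒪[F] ⧸ T)) = U \ V := by
    ext w
    simp only [Set.mem_setOf_eq, Set.mem_sdiff, hU, hV]
    constructor
    · rintro ⟨y, hyw, hyM, hyM1, hyc⟩
      refine ⟨⟨y, hyw, hyM, hyc⟩, ?_⟩
      rintro ⟨y', hy'w, hy'M1, -⟩
      apply hyM1
      have hdiff : y - y' ∈ T := by
        rw [← Ideal.Quotient.eq, hyw, hy'w]
      have hdiff' : y - y' ∈ Ideal.span ({π ^ (M + 1)} : Set 𝒪[F]) := hle (by omega) hdiff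
      have : y = (y - y') + y' := by ring
      rw [this]
      exact Ideal.add_mem _ hdiff' hy'M1
    · rintro ⟨⟨y, hyw, hyM, hyc⟩, hV⟩
      exact ⟨y, hyw, hyM, fun hyM1 => hV ⟨y, hyw, hyM1, hyc⟩, hyc⟩
  -- finiteness of the quotient
  have hfin : Finite (𝒪[F] ⧸ T) := by
    apply Nat.finite_of_card_ne_zero
    rw [hT, natCard_quotient_span_pow hϖ (2 * M)]
    exact pow_ne_zero _ (Nat.pos_iff_ne_zero.1 Nat.card_pos)
  haveI := hfin
  have hcard : Nat.card {w : 𝒪[F] ⧸ T // ∃ y : 𝒪[F], Ideal.Quotient.mk T y = w ∧ y ∈ Ideal.span ({π ^ M} : Set 𝒪[F]) ∧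
      y ∉ Ideal.span ({π ^ (M + 1)} : Set 𝒪[F]) ∧ π ^ k * y - c ∈ T} = Nat.card U - Nat.card V := by
    change Nat.card ↥({w : 𝒪[F] ⧸ T | ∃ y : 𝒪[F], Ideal.Quotient.mk T y = w ∧ y ∈ Ideal.span ({π ^ M} : Set 𝒪[F]) ∧
      y ∉ Ideal.span ({π ^ (M + 1)} : Set 𝒪[F]) ∧ π ^ k * y - c ∈ T} : Set (𝒪[F] ⧸ T)) = _
    rw [hS, Nat.card_coe_set_eq, Set.ncard_sdiff hVU, ← Nat.card_coe_set_eq, ← Nat.card_coe_set_eq]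
  rw [hcard, hU', hV']
  by_cases hMk : M ≤ k
  · rw [if_pos hMk]
    have e1 : min (2 * M) (k + M) = 2 * M := by omega
    have e2 : min (2 * M) (k + (M + 1)) = 2 * M := by omega
    have e3 : 2 * M - max M (2 * M - k) = M := by omega
    have e4 : 2 * M - max (M + 1) (2 * M - k) = M - 1 := by omega
    rw [e1, e2, e3, e4]
    split_ifs with hc
    · obtain ⟨M', rfl⟩ := Nat.exists_eq_add_of_le' hM1
      rw [Nat.add_sub_cancel, pow_succ, Nat.sub_one_mul, mul_comm]
    · rfl
  · rw [if_neg hMk]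
    rw [not_le] at hMk
    have e1 : min (2 * M) (k + M) = M + k := by omega
    have e2 : min (2 * M) (k + (M + 1)) = M + k + 1 := by omega
    have e3 : 2 * M - max M (2 * M - k) = k := by omega
    have e4 : 2 * M - max (M + 1) (2 * M - k) = k := by omega
    rw [e1, e2, e3, e4]
    have hsub : Ideal.span ({π ^ (M + k + 1)} : Set 𝒪[F]) ≤ Ideal.span {π ^ (M + k)} := hle (Nat.le_succ _)
    by_cases h1 : c ∈ Ideal.span ({π ^ (M + k)} : Set 𝒪[F])
    · by_cases h2 : c ∈ Ideal.span ({π ^ (M + k + 1)} : Set 𝒪[F])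
      · rw [if_pos h1, if_pos h2, if_neg (fun h => h.2 h2), Nat.sub_self]
      · rw [if_pos h1, if_neg h2, if_pos ⟨h1, h2⟩, Nat.sub_zero]
    · have h2 : c ∉ Ideal.span ({π ^ (M + k + 1)} : Set 𝒪[F]) := fun h => h1 (hsub h)
      rw [if_neg h1, if_neg h2, if_neg (fun h => h1 h.1)]

include hϖ in
/-- **(C3) `b = 0`**: one class (the product order `𝒪 × O_{N″}`; it carries `q^{N″}` lattices, the boundary term of the law). [cite: Neukirch1999, Ch. I §12] -/
theorem natCard_quotient_span_pow_zero : Nat.card (𝒪[F] ⧸ Ideal.span ({(⟨ϖ, hϖ.mem⟩ : 𝒪[F]) ^ 0} : Set 𝒪[F])) = 1 := by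
  rw [natCard_quotient_span_pow hϖ 0, pow_zero]

end Literature.NumberTheory.Automorphic
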